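import Mathlib
import Summits.ValiantsHypothesis.ValiantsHypothesis.Theorems.MonotoneRestorationOrbitRestorationQPDepthThreeRungDefs
import Literature.Computability.Complexity.ConstantDepthIMMProofs
import Literature.Computability.AlgebraicComplexity.ArithCircuitProjections
import Literature.Computability.AlgebraicComplexity.IMMCompleteness
import Literature.Computability.AlgebraicComplexity.ValiantCompleteness
import Literature.Computability.AlgebraicComplexity.BLMW11FormulasWeaklySkew
import Literature.Computability.AlgebraicComplexity.ValiantConjectureEquivProofs
import HarnessLib
import Summits.ValiantsHypothesis.ValiantsHypothesis.Theorems.MonotoneRestorationOrbitRestorationQPPermanentOutsideRung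

/-!
# Route MonotoneRestoration — crux `OrbitRestorationQP` (stmt-ValiantsHypothesis-18293), line `depth-three-rung`:
# THE PERMANENT IS OUTSIDE EVERY CONSTANT RUNG OF THE PRODUCT-DEPTH LADDER, UNCONDITIONALLY

The skeleton `Cruxes/OrbitRestorationQP/Lines/depth_three_rung.lean` organises the crux as a ladder of rungs
`ProductDepthRestorationQP δ = RestorationOn (PDClass δ)`: restore every matrix-symmetric family of the product-depth-`δ`
slice of `VP` (`PDClass δ n c`: degree and complexity `≤ n^c + c` and a product-depth-`≤ δ n` circuit with `≤ n^c + c`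
wires).  The registered open stubs are the first rung `A_∞ = stub_sigmaPiSigmaValue` (`δ ≡ 1`, `ΣΠΣ`) and the LIMIT
`stub_logDepthRestoration` (`δ n = c₀ (log₂ n + 1)`, all of `VP` by VSBR).  `Theorems/…RungCalibration.lean` reads off the
"lower-bound content" of a rung through the permanent (Dawar–Wilsenach Thm 7.1: `per` has no quasi-polynomial orbit
circuits): a rung with `per` in its hypothesis class decides Valiant's hypothesis for `per` in its currency.  For `δ ≡ 1`
the sibling file `Theorems/…PermanentOutsideRung.lean` (p829878) proves `per ∉ PDClass 1 · c` unconditionally.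

This file proves the same for EVERY CONSTANT product depth:

* `exists_circuit_immPoly_of_pdClass` — product-depth-`≤ Δ` circuits for `per_N` with `≤ N^c + c` wires give, for
  some `a` and all `d ≤ n`, product-depth-`≤ Δ` circuits for `IMM_{n,d}` (trace form) with `≤ (n^a + a)^c + c` GATES:
  `n ↦ IMM_{n,n}` is `VP_ws` (`isVPwsFamily_immPoly_sq`), hence `VNP` (also renamed into `Fin (n³)`,
  `IsVNPFamily.renameEquiv`), hence a p-projection of `per` (`isVNPComplete_perPoly_holds ℂ`); circuits are pruned to
  gates `≤` wires (`ArithCircuit.exists_size_le_edgeSize`) and projected (`ArithCircuit.substVC`) onto `IMM_{n,n}` and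
  then onto `IMM_{n,d}` by identity matrices (`immTrunc`, `aeval_immTrunc_immPoly`);
* `final_contradiction` — the arithmetic: no gate bound `(n^a + a)^c + c` is compatible with `n^{d^δ}` for
  `d₀ ≤ d ≤ ε log n` (take `d^δ ≥ (a+1)(c+1)+1`, `n ≥ exp(d/ε)`);
* `perPoly_not_pdClass_const` — **for every `Δ`: `¬ ∃ c, ∀ n, PDClass (fun _ => Δ) n c (per_n)`**, by
  Limaye–Srinivasan–Tavenas at product depth `max Δ 1` (`lst_constantDepth_imm_lower_bound_holds`, PROVED in the tree);
  `exists_perPoly_not_pdClass` — the levelwise form.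

Reading for the line: NO CONSTANT RUNG of the ladder (`ΣΠΣ`, `ΣΠΣΠΣ`, …, any fixed number of product layers) has the
permanent in its hypothesis class, so none of them implies anything about `per` that the tree does not already prove,
and none of them can be refuted through `per` or — by the same transfer — through any family onto which `IMM` projects
with polynomial blow-up; the ladder's content about the permanent sits entirely in the non-constant regime
`δ n → ∞` below the limit `c₀ (log₂ n + 1)`.  Honest label: calibration (assembly of landed theorems); no stub is
closed; VP ≠ VNP is not touched.

## References
* N. Limaye, S. Srinivasan, S. Tavenas, *Superpolynomial lower bounds against low-depth algebraic circuits*,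
  J. ACM 72 (2025), Art. 26 (FOCS 2021), Cor. 4. [LimayeSrinivasanTavenas2025]
* L. G. Valiant, *Completeness classes in algebra*, STOC 1979 (VNP-completeness of the permanent). [Valiant1979]
* P. Bürgisser, *Completeness classes in algebraic complexity theory*, arXiv:2406.06217 (2024), Cor. 2.24
  (`IMM` is `VBP`-complete). [Burgisser2024]
-/

noncomputable section

open scoped Classical

-- `Summit.ValiantsHypothesis.ValiantsHypothesis.…` is the tree's single-conjunct layout (Sub = Summit).
set_option linter.dupNamespace false

namespace Summit.ValiantsHypothesis.ValiantsHypothesis.Theorems.OrbitRestorationQPDepthThreeRung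

namespace PermanentOutsideConstantDepth

open MvPolynomial Literature.Computability.AlgebraicComplexity Literature.Computability.Complexity

/-! ### Projections given as variables-or-constants come from a `substVC` datum -/

/-- A Valiant projection datum (`every a i` is a variable or a constant) is the substitution function of some
`substVC` datum. [folklore] -/
theorem exists_substVCFun_eq {σ τ : Type*} (a : σ → MvPolynomial τ ℂ)
    (ha : ∀ i, (∃ j, a i = X j) ∨ ∃ c, a i = C c) :
    ∃ s : σ → τ ⊕ ℂ, ArithCircuit.substVCFun s = a := by
  refine ⟨fun i => if h : ∃ j, a i = X j then Sum.inl h.choose else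
    Sum.inr (((ha i).resolve_left h).choose), funext fun i => ?_⟩
  unfold ArithCircuit.substVCFun
  by_cases h : ∃ j, a i = X j
  · simp only [h, dite_true, Sum.elim_inl]
    exact h.choose_spec.symm
  · simp only [h, dite_false, Sum.elim_inr]
    exact ((ha i).resolve_left h).choose_spec.symm

/-! ### `IMM_{n,d}` is a projection of `IMM_{n,n}` (trace form) for `d ≤ n` -/

/-- Substituting identity matrices for the factors `t ≥ d` turns `IMM_{n,n'} = tr(X^{(0)} ⋯ X^{(n'-1)})` into
`IMM_{n,d}`, for `d ≤ n'`. [cite: LimayeSrinivasanTavenas2025, §2] -/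
theorem aeval_immTrunc_immPoly {n n' d : ℕ} (hd : d ≤ n') :
    aeval (ArithCircuit.substVCFun (immTrunc ℂ n n' d)) (immPoly n n' ℂ) = immPoly n d ℂ := by
  unfold immPoly Matrix.trace
  rw [map_sum]
  refine Finset.sum_congr rfl fun i _ => ?_
  simp only [Matrix.diag_apply]
  exact aeval_immTrunc_immMatrix ℂ hd i i

/-! ### From constant-depth circuits for the permanent to constant-depth circuits for `IMM` -/

/-- The number of variables of `IMM_{n,n}` is p-bounded. [folklore] -/
theorem isPBounded_card_immVars : IsPBounded fun n => Fintype.card (Fin n × Fin n × Fin n) := by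
  refine ⟨3, fun n => ?_⟩
  simp only [Fintype.card_prod, Fintype.card_fin]
  nlinarith [Nat.zero_le n]

/-- `n ↦ IMM_{n,n}` (trace form), renamed into the variables `Fin (n³)`, is a `VNP` family over `ℂ`.
[cite: Burgisser2024, Rem. 2.8 and Cor. 2.24] -/
theorem isVNPFamily_immPoly_fin :
    IsVNPFamily fun n => renameEquiv ℂ (Fintype.equivFin (Fin n × Fin n × Fin n)) (immPoly n n ℂ) := by
  have hVP : IsVPFamily fun n => immPoly n n ℂ :=
    (isVPwsFamily_immPoly_sq ℂ).isVPFamily isPBounded_card_immVars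
  have hVNP : IsVNPFamily fun n => immPoly n n ℂ := IsVPFamily.isVNPFamily_holds' hVP
  exact hVNP.renameEquiv fun n => Fintype.equivFin (Fin n × Fin n × Fin n)

/-- **Product-depth-`Δ` circuits for `IMM` from product-depth-`Δ` circuits for the permanent.**  If `per_N` has
product-depth-`≤ Δ` circuits with `≤ N^c + c` wires for every `N`, then for some `a` and all `d ≤ n` the polynomial
`IMM_{n,d}` (trace form) has a product-depth-`≤ Δ` circuit with at most `(n^a + a)^c + c` GATES.
[cite: Valiant1979] [cite: Burgisser2024, Cor. 2.24] -/
theorem exists_circuit_immPoly_of_pdClass {Δ c : ℕ}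
    (hper : ∀ N : ℕ, PDClass (fun _ => Δ) N c (perPoly (Fin N) ℂ)) :
    ∃ a : ℕ, ∀ n d : ℕ, d ≤ n →
      ∃ C : ArithCircuit ℂ (Fin d × Fin n × Fin n), C.productDepth ≤ Δ ∧ C.Computes (immPoly n d ℂ) ∧
        C.size ≤ (n ^ a + a) ^ c + c := by
  -- Valiant's completeness of the permanent applied to the `VNP` family `IMM_{n,n}`
  have h2 : ringChar ℂ ≠ 2 := by rw [ringChar.eq_zero]; norm_num
  obtain ⟨t, ⟨a, ha⟩, hproj⟩ :=
    ((isVNPComplete_perPoly_holds ℂ) h2).2 _ _ isVNPFamily_immPoly_fin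
  refine ⟨a, fun n d hdn => ?_⟩
  set e := Fintype.equivFin (Fin n × Fin n × Fin n) with he
  obtain ⟨α, hα, hG⟩ := hproj n
  obtain ⟨s₁, hs₁⟩ := exists_substVCFun_eq α hα
  -- the product-depth-`Δ` circuit for `per_{t n}`, pruned so that gates ≤ wires
  obtain ⟨_, _, P, hPc, hPd, hPe⟩ := hper (t n)
  obtain ⟨P', hP'e, hP'd, hP'w, hP's⟩ := P.exists_size_le_edgeSize
  -- project: per_{t n} ↦ IMM_{n,n} (in `Fin (n³)`) ↦ IMM_{n,n} ↦ IMM_{n,d}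
  let C₁ := P'.substVC s₁
  let C₂ := C₁.substVC fun x => Sum.inl (e.symm x)
  let C₃ := C₂.substVC (immTrunc ℂ n n d)
  refine ⟨C₃, ?_, ?_, ?_⟩
  · simp only [C₃, C₂, C₁, ArithCircuit.productDepth_substVC]
    exact hP'd.trans hPd
  · have h₁ : C₁.eval = renameEquiv ℂ e (immPoly n n ℂ) := by
      simp only [C₁, ArithCircuit.eval_substVC, hs₁, hP'e]
      rw [show P.eval = perPoly (Fin (t n)) ℂ from hPc]
      exact hG.symm
    have h₂ : C₂.eval = immPoly n n ℂ := by
      simp only [C₂, ArithCircuit.eval_substVC, h₁]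
      have hfun : ArithCircuit.substVCFun (k := ℂ) (fun x : Fin (Fintype.card (Fin n × Fin n × Fin n)) =>
          (Sum.inl (e.symm x) : (Fin n × Fin n × Fin n) ⊕ ℂ)) = fun x => X (e.symm x) := by
        funext x; rfl
      rw [hfun, renameEquiv_apply, aeval_rename]
      have : (fun x : Fin (Fintype.card (Fin n × Fin n × Fin n)) => (X (e.symm x) :
          MvPolynomial (Fin n × Fin n × Fin n) ℂ)) ∘ e = X := by
        funext v; simp
      rw [this, aeval_X_left]
      rfl
    show C₃.eval = immPoly n d ℂ
    simp only [C₃, ArithCircuit.eval_substVC, h₂]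
    exact aeval_immTrunc_immPoly hdn
  · simp only [C₃, C₂, C₁, ArithCircuit.size_substVC]
    calc P'.size ≤ P'.edgeSize := hP's
      _ ≤ P.edgeSize := hP'w
      _ ≤ t n ^ c + c := hPe
      _ ≤ (n ^ a + a) ^ c + c := by
        have := ha n
        gcongr

/-! ### Arithmetic of the final contradiction -/

/-- `n^a + a ≤ n^(a+1)` for `n ≥ 2`, `n ≥ a`. [folklore] -/
theorem pow_add_le_pow_succ {n a : ℕ} (hn : 2 ≤ n) (han : a ≤ n) : n ^ a + a ≤ n ^ (a + 1) := by
  rcases Nat.eq_zero_or_pos a with rfl | ha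
  · simp; omega
  · have h1 : a ≤ n ^ a := by
      calc a ≤ n := han
        _ = n ^ 1 := (pow_one n).symm
        _ ≤ n ^ a := Nat.pow_le_pow_right (by omega) ha
    calc n ^ a + a ≤ n ^ a + n ^ a := by omega
      _ = 2 * n ^ a := by ring
      _ ≤ n * n ^ a := Nat.mul_le_mul_right _ hn
      _ = n ^ (a + 1) := by ring

/-- The polynomial gate bound is eventually below `n^E`, `E = (a+1)(c+1)+1`. [folklore] -/
theorem poly_lt_pow {n a c : ℕ} (hn : 2 ≤ n) (han : a ≤ n) (hcn : c ≤ n) :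
    (n ^ a + a) ^ c + c < n ^ ((a + 1) * (c + 1) + 1) := by
  have h1 : (n ^ a + a) ^ c ≤ n ^ ((a + 1) * c) := by
    calc (n ^ a + a) ^ c ≤ (n ^ (a + 1)) ^ c := Nat.pow_le_pow_left (pow_add_le_pow_succ hn han) c
      _ = n ^ ((a + 1) * c) := by rw [← pow_mul]
  have h2 : c ≤ n ^ ((a + 1) * c) := by
    rcases Nat.eq_zero_or_pos c with rfl | hc
    · simp
    · calc c ≤ n := hcn
        _ = n ^ 1 := (pow_one n).symm
        _ ≤ n ^ ((a + 1) * c) := Nat.pow_le_pow_right (by omega) (by nlinarith)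
  have h3 : (n ^ a + a) ^ c + c ≤ n ^ ((a + 1) * c + 1) := by
    calc (n ^ a + a) ^ c + c ≤ n ^ ((a + 1) * c) + n ^ ((a + 1) * c) := Nat.add_le_add h1 h2
      _ = 2 * n ^ ((a + 1) * c) := by ring
      _ ≤ n * n ^ ((a + 1) * c) := Nat.mul_le_mul_right _ hn
      _ = n ^ ((a + 1) * c + 1) := by ring
  calc (n ^ a + a) ^ c + c ≤ n ^ ((a + 1) * c + 1) := h3
    _ < n ^ ((a + 1) * (c + 1) + 1) := Nat.pow_lt_pow_right (by omega) (by nlinarith)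

/-- **The final contradiction**: no polynomial gate bound `(n^a + a)^c + c` is compatible with the
Limaye–Srinivasan–Tavenas bound `n^{d^δ}` for `d₀ ≤ d ≤ ε log n` — choose `d` with `d^δ ≥ (a+1)(c+1)+1` and `n`
beyond `exp(d/ε)`. [cite: LimayeSrinivasanTavenas2025, Cor. 4] -/
theorem final_contradiction {a c : ℕ} {δ ε : ℝ} (hδ : 0 < δ) (hε : 0 < ε) (d₀ : ℕ)
    (H : ∀ n d : ℕ, d₀ ≤ d → d ≤ n → (d : ℝ) ≤ ε * Real.log n →
      ∃ s : ℕ, (n : ℝ) ^ ((d : ℝ) ^ δ) ≤ (s : ℝ) ∧ s ≤ (n ^ a + a) ^ c + c) : False := by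
  -- the exponent `E` and a `d` with `d ^ δ ≥ E`
  set E : ℕ := (a + 1) * (c + 1) + 1 with hE
  set D : ℕ := max d₀ ⌈((E : ℝ) ^ δ⁻¹)⌉₊ with hD
  have hDδ : (E : ℝ) ≤ (D : ℝ) ^ δ := by
    have hE0 : (0 : ℝ) ≤ (E : ℝ) := by positivity
    have h1 : (E : ℝ) ^ δ⁻¹ ≤ (D : ℝ) := by
      calc (E : ℝ) ^ δ⁻¹ ≤ (⌈((E : ℝ) ^ δ⁻¹)⌉₊ : ℝ) := Nat.le_ceil _
        _ ≤ (D : ℝ) := by exact_mod_cast le_max_right _ _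
    calc (E : ℝ) = ((E : ℝ) ^ δ⁻¹) ^ δ := (Real.rpow_inv_rpow hE0 hδ.ne').symm
      _ ≤ (D : ℝ) ^ δ := Real.rpow_le_rpow (by positivity) h1 hδ.le
  -- a large `n`
  set n : ℕ := ⌈Real.exp ((D : ℝ) / ε)⌉₊ + D + a + c + 2 with hn
  have hn2 : 2 ≤ n := by omega
  have hDn : D ≤ n := by omega
  have han : a ≤ n := by omega
  have hcn : c ≤ n := by omega
  have hn1 : (1 : ℝ) ≤ (n : ℝ) := by exact_mod_cast (show 1 ≤ n by omega)
  have hlog : (D : ℝ) ≤ ε * Real.log n := by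
    have hexp : Real.exp ((D : ℝ) / ε) ≤ (n : ℝ) := by
      calc Real.exp ((D : ℝ) / ε) ≤ (⌈Real.exp ((D : ℝ) / ε)⌉₊ : ℝ) := Nat.le_ceil _
        _ ≤ (n : ℝ) := by rw [hn]; push_cast; linarith
    have h1 : (D : ℝ) / ε ≤ Real.log n := by
      have := Real.log_le_log (Real.exp_pos _) hexp
      rwa [Real.log_exp] at this
    calc (D : ℝ) = ε * ((D : ℝ) / ε) := by field_simp
      _ ≤ ε * Real.log n := mul_le_mul_of_nonneg_left h1 hε.le
  obtain ⟨s, hs, hsle⟩ := H n D (le_max_left _ _) hDn hlog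
  -- `n ^ E ≤ n ^ (D ^ δ) ≤ s ≤ (n^a + a)^c + c < n ^ E`
  have hlow : ((n ^ E : ℕ) : ℝ) ≤ (n : ℝ) ^ ((D : ℝ) ^ δ) := by
    rw [Nat.cast_pow, ← Real.rpow_natCast]
    exact Real.rpow_le_rpow_of_exponent_le hn1 hDδ
  have hlt : (n ^ a + a) ^ c + c < n ^ E := poly_lt_pow hn2 han hcn
  have : ((n ^ E : ℕ) : ℝ) ≤ (((n ^ a + a) ^ c + c : ℕ) : ℝ) :=
    hlow.trans (hs.trans (by exact_mod_cast hsle))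
  exact absurd (by exact_mod_cast this : n ^ E ≤ (n ^ a + a) ^ c + c) (not_le.2 hlt)

/-! ### The theorem -/

/-- **THE PERMANENT IS OUTSIDE EVERY CONSTANT RUNG OF THE PRODUCT-DEPTH LADDER, UNCONDITIONALLY**: for every constant
product-depth `Δ` (`Δ = 1`: `ΣΠΣ`; `Δ = 2`: `ΣΠΣΠΣ`; …) no constant `c` gives, at every order `n`, a product-depth-`≤ Δ`
circuit with `≤ n^c + c` wires computing `per_n` inside the `VP` envelope — i.e. `per ∉ PDClass (fun _ => Δ) · c` for all
`c`, the hypothesis class of the rung `ProductDepthRestorationQP (fun _ => Δ)` of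
`Cruxes/OrbitRestorationQP/Lines/depth_three_rung.lean`.  Limaye–Srinivasan–Tavenas at product-depth `max Δ 1` (proved in
the tree) composed with Valiant's completeness of the permanent and the `VBP`-membership of `IMM`.  The case `Δ = 1` is
`PermanentOutsideRung.perPoly_not_pdClassOne` (landed, p829878); the present statement says that NO constant rung of
the ladder carries content about the permanent — only the limit `stub_logDepthRestoration` (product depth
`c₀ (log₂ n + 1)`, all of `VP` by VSBR) does. [cite: LimayeSrinivasanTavenas2025, Cor. 4] [cite: Valiant1979] -/
theorem perPoly_not_pdClass_const (Δ : ℕ) :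
    ¬ ∃ c : ℕ, ∀ n : ℕ, PDClass (fun _ => Δ) n c (perPoly (Fin n) ℂ) := by
  rintro ⟨c, hper⟩
  -- pass to product depth `max Δ 1 ≥ 1`
  have hper' : ∀ N : ℕ, PDClass (fun _ => max Δ 1) N c (perPoly (Fin N) ℂ) := fun N => by
    obtain ⟨h₁, h₂, P, hPc, hPd, hPe⟩ := hper N
    exact ⟨h₁, h₂, P, hPc, hPd.trans (le_max_left _ _), hPe⟩
  obtain ⟨a, hIMM⟩ := exists_circuit_immPoly_of_pdClass hper'
  obtain ⟨δ, hδ, ε, hε, d₀, H⟩ := lst_constantDepth_imm_lower_bound_holds ℂ (max Δ 1) (le_max_right _ _)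
  refine final_contradiction (a := a) (c := c) hδ hε d₀ fun n d hd hdn hlog => ?_
  obtain ⟨C, hCd, hCc, hCs⟩ := hIMM n d hdn
  exact ⟨C.size, H n d hd hlog C hCd hCc, hCs⟩

/-- Levelwise form: for every constant product depth `Δ` and every exponent `c` there is an order `n` at which
`per_n ∉ PDClass (fun _ => Δ) n c`. [cite: LimayeSrinivasanTavenas2025, Cor. 4] -/
theorem exists_perPoly_not_pdClass (Δ c : ℕ) : ∃ n : ℕ, ¬ PDClass (fun _ => Δ) n c (perPoly (Fin n) ℂ) := by
  by_contra h
  push Not at h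
  exact perPoly_not_pdClass_const Δ ⟨c, h⟩

/-! ### Appended (v2): the envelope-free form, and no `VNP`-complete family has polynomial constant-depth circuits -/

/-- Envelope-free variant of `exists_circuit_immPoly_of_pdClass` (only the CIRCUIT datum for the permanent is used,
not the degree/complexity envelope of `PDClass`). [cite: Valiant1979] [cite: Burgisser2024, Cor. 2.24] -/
theorem exists_circuit_immPoly_of_circuits {Δ c : ℕ}
    (hper : ∀ N : ℕ, ∃ P : ArithCircuit ℂ (Fin N × Fin N), P.Computes (perPoly (Fin N) ℂ) ∧
      P.productDepth ≤ Δ ∧ P.edgeSize ≤ N ^ c + c) :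
    ∃ a : ℕ, ∀ n d : ℕ, d ≤ n →
      ∃ C : ArithCircuit ℂ (Fin d × Fin n × Fin n), C.productDepth ≤ Δ ∧ C.Computes (immPoly n d ℂ) ∧
        C.size ≤ (n ^ a + a) ^ c + c := by
  have h2 : ringChar ℂ ≠ 2 := by rw [ringChar.eq_zero]; norm_num
  obtain ⟨t, ⟨a, ha⟩, hproj⟩ :=
    ((isVNPComplete_perPoly_holds ℂ) h2).2 _ _ isVNPFamily_immPoly_fin
  refine ⟨a, fun n d hdn => ?_⟩
  set e := Fintype.equivFin (Fin n × Fin n × Fin n) with he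
  obtain ⟨α, hα, hG⟩ := hproj n
  obtain ⟨s₁, hs₁⟩ := exists_substVCFun_eq α hα
  obtain ⟨P, hPc, hPd, hPe⟩ := hper (t n)
  obtain ⟨P', hP'e, hP'd, hP'w, hP's⟩ := P.exists_size_le_edgeSize
  let C₁ := P'.substVC s₁
  let C₂ := C₁.substVC fun x => Sum.inl (e.symm x)
  let C₃ := C₂.substVC (immTrunc ℂ n n d)
  refine ⟨C₃, ?_, ?_, ?_⟩
  · simp only [C₃, C₂, C₁, ArithCircuit.productDepth_substVC]
    exact hP'd.trans hPd
  · have h₁ : C₁.eval = renameEquiv ℂ e (immPoly n n ℂ) := by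
      simp only [C₁, ArithCircuit.eval_substVC, hs₁, hP'e]
      rw [show P.eval = perPoly (Fin (t n)) ℂ from hPc]
      exact hG.symm
    have h₂ : C₂.eval = immPoly n n ℂ := by
      simp only [C₂, ArithCircuit.eval_substVC, h₁]
      have hfun : ArithCircuit.substVCFun (k := ℂ) (fun x : Fin (Fintype.card (Fin n × Fin n × Fin n)) =>
          (Sum.inl (e.symm x) : (Fin n × Fin n × Fin n) ⊕ ℂ)) = fun x => X (e.symm x) := by
        funext x; rfl
      rw [hfun, renameEquiv_apply, aeval_rename]
      have : (fun x : Fin (Fintype.card (Fin n × Fin n × Fin n)) => (X (e.symm x) :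
          MvPolynomial (Fin n × Fin n × Fin n) ℂ)) ∘ e = X := by
        funext v; simp
      rw [this, aeval_X_left]
      rfl
    show C₃.eval = immPoly n d ℂ
    simp only [C₃, ArithCircuit.eval_substVC, h₂]
    exact aeval_immTrunc_immPoly hdn
  · simp only [C₃, C₂, C₁, ArithCircuit.size_substVC]
    calc P'.size ≤ P'.edgeSize := hP's
      _ ≤ P.edgeSize := hP'w
      _ ≤ t n ^ c + c := hPe
      _ ≤ (n ^ a + a) ^ c + c := by
        have := ha n
        gcongr

/-- **ENVELOPE-FREE FORM**: for every constant product depth `Δ` and every `c` the permanent family does NOT have, at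
every order `n`, a product-depth-`≤ Δ` circuit with `≤ n^c + c` wires (no degree/complexity side conditions).
[cite: LimayeSrinivasanTavenas2025, Cor. 4] [cite: Valiant1979] -/
theorem perPoly_no_constDepthCircuits (Δ : ℕ) :
    ¬ ∃ c : ℕ, ∀ n : ℕ, ∃ P : ArithCircuit ℂ (Fin n × Fin n), P.Computes (perPoly (Fin n) ℂ) ∧
      P.productDepth ≤ Δ ∧ P.edgeSize ≤ n ^ c + c := by
  rintro ⟨c, hper⟩
  have hper' : ∀ N : ℕ, ∃ P : ArithCircuit ℂ (Fin N × Fin N), P.Computes (perPoly (Fin N) ℂ) ∧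
      P.productDepth ≤ max Δ 1 ∧ P.edgeSize ≤ N ^ c + c := fun N => by
    obtain ⟨P, hPc, hPd, hPe⟩ := hper N
    exact ⟨P, hPc, hPd.trans (le_max_left _ _), hPe⟩
  obtain ⟨a, hIMM⟩ := exists_circuit_immPoly_of_circuits hper'
  obtain ⟨δ, hδ, ε, hε, d₀, H⟩ := lst_constantDepth_imm_lower_bound_holds ℂ (max Δ 1) (le_max_right _ _)
  refine final_contradiction (a := a) (c := c) hδ hε d₀ fun n d hd hdn hlog => ?_
  obtain ⟨C, hCd, hCc, hCs⟩ := hIMM n d hdn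
  exact ⟨C.size, H n d hd hlog C hCd hCc, hCs⟩

/-- A polynomial bound `(m^a + a)^c + c` is a p-bound: `≤ m^{c'} + c'` for one `c'` and all `m`. [folklore] -/
theorem exists_pbound_comp (a c : ℕ) : ∃ c' : ℕ, ∀ m : ℕ, (m ^ a + a) ^ c + c ≤ m ^ c' + c' := by
  set m₀ : ℕ := a + c + 2 with hm₀
  set B : ℕ := (m₀ ^ a + a) ^ c + c with hB
  refine ⟨(a + 1) * (c + 1) + 1 + B, fun m => ?_⟩
  by_cases hm : m₀ ≤ m
  · have hlt := poly_lt_pow (n := m) (a := a) (c := c) (by omega) (by omega) (by omega)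
    have h1 : m ^ ((a + 1) * (c + 1) + 1) ≤ m ^ ((a + 1) * (c + 1) + 1 + B) :=
      Nat.pow_le_pow_right (by omega) (by omega)
    omega
  · push Not at hm
    have hmono : (m ^ a + a) ^ c + c ≤ B := by
      have : m ^ a ≤ m₀ ^ a := Nat.pow_le_pow_left hm.le a
      have : (m ^ a + a) ^ c ≤ (m₀ ^ a + a) ^ c := Nat.pow_le_pow_left (by omega) c
      omega
    calc (m ^ a + a) ^ c + c ≤ B := hmono
      _ ≤ m ^ ((a + 1) * (c + 1) + 1 + B) + ((a + 1) * (c + 1) + 1 + B) := by omega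

/-- **NO `VNP`-COMPLETE FAMILY HAS POLYNOMIAL-SIZE CIRCUITS OF CONSTANT PRODUCT DEPTH OVER `ℂ`** (tree's
`IsVNPComplete`; any constant `Δ`): else the permanent (a `VNP` family, `isVNPFamily_perPoly_holds`, `Fin`-renamed)
is a p-projection of `f`, projections keep product depth and wires (`PermanentOutsideRung.exists_sps_of_isProjection`),
contradicting `perPoly_no_constDepthCircuits`.  `Δ = 1`: `PermanentOutsideRung.not_isVNPComplete_of_pdClassOne`.
[cite: LimayeSrinivasanTavenas2025, Cor. 4] [cite: Valiant1979] -/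
theorem not_isVNPComplete_of_constDepthCircuits (Δ : ℕ) {f : (n : ℕ) → MvPolynomial (Fin n × Fin n) ℂ}
    (hf : ∃ c : ℕ, ∀ n : ℕ, ∃ P : ArithCircuit ℂ (Fin n × Fin n), P.Computes (f n) ∧
      P.productDepth ≤ Δ ∧ P.edgeSize ≤ n ^ c + c) :
    ¬ IsVNPComplete f := by
  intro hVNPc
  obtain ⟨c, hf⟩ := hf
  have hperVNP : IsVNPFamily fun n =>
      renameEquiv ℂ (Fintype.equivFin (Fin n × Fin n)) (perPoly (Fin n) ℂ) :=
    (isVNPFamily_perPoly_holds ℂ).renameEquiv fun n => Fintype.equivFin (Fin n × Fin n)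
  obtain ⟨t, ⟨a, ha⟩, hproj⟩ := hVNPc.2 _ _ hperVNP
  obtain ⟨c', hc'⟩ := exists_pbound_comp a c
  refine perPoly_no_constDepthCircuits Δ ⟨c', fun m => ?_⟩
  have h := PermanentOutsideRung.isProjection_rename (hproj m) (Fintype.equivFin (Fin m × Fin m)).symm
  have hgg : rename (Fintype.equivFin (Fin m × Fin m)).symm
      (renameEquiv ℂ (Fintype.equivFin (Fin m × Fin m)) (perPoly (Fin m) ℂ)) = perPoly (Fin m) ℂ := by
    rw [renameEquiv_apply, rename_rename, Equiv.symm_comp_self, rename_id_apply]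
  rw [hgg] at h
  obtain ⟨P, hPc, hPd, hPe⟩ := hf (t m)
  obtain ⟨Q, hQc, hQd, hQe, _⟩ := PermanentOutsideRung.exists_sps_of_isProjection h hPc
  refine ⟨Q, hQc, hQd.trans hPd, hQe.trans (hPe.trans ?_)⟩
  calc t m ^ c + c ≤ (m ^ a + a) ^ c + c := by have := ha m; gcongr
    _ ≤ m ^ c' + c' := hc' m

/-- No `VNP`-complete family lies in the hypothesis class `PDClass (fun _ => Δ) · c` of any constant rung.
[cite: LimayeSrinivasanTavenas2025, Cor. 4] -/
theorem not_isVNPComplete_of_pdClass_const (Δ : ℕ) {f : (n : ℕ) → MvPolynomial (Fin n × Fin n) ℂ}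
    (hf : ∃ c : ℕ, ∀ n : ℕ, PDClass (fun _ => Δ) n c (f n)) : ¬ IsVNPComplete f := by
  obtain ⟨c, hf⟩ := hf
  exact not_isVNPComplete_of_constDepthCircuits Δ ⟨c, fun n => (hf n).2.2⟩

end PermanentOutsideConstantDepth

end Summit.ValiantsHypothesis.ValiantsHypothesis.Theorems.OrbitRestorationQPDepthThreeRung

end
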